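import Mathlib
import HarnessLib

/-!
# Covariance of character periods under right translation (right-invariant measure)

Topic `MeasureTheory/Group`; namespace `Literature.MeasureTheory.Group.ToricPeriod`.

For a group `K` with a right-invariant measure `dk` and a unitary character `ξ : K →* ℂ` (`‖ξ k‖ = 1`), the
`ξ`-period `P_ξ(F) := ∫_K F(k) conj ξ(k) dk` of a function `F : K → ℂ` transforms under right translation by the
character: `P_ξ(F(· s)) = ξ(s) P_ξ(F)` (`period_mul_right`, the substitution `k ↦ k s⁻¹`; `conj_map_mul_inv` is the
bare identity `conj ξ(k s⁻¹) = conj ξ(k) ξ(s)`).  Consequently a toric period `x ↦ ∫_K x(ι k) conj ξ(k) dk` along an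
equivariant map `ι : K → Y` (`act t (ι k) = ι (k · cl t)` for an action `act` of a group `Tc` on `Y` and a
homomorphism `cl : Tc →* K`) is `(ξ ∘ cl)`-covariant: `period_equivariant`, and `period_equivariant_op` (the same for
translation operators `Rc t` on a function space with `ev (Rc t x) = ev x ∘ act t`).  This is the elementary
covariance `𝒫_χ(R(t)φ) = χ(t) 𝒫_χ(φ)` of toric / Waldspurger-type period functionals [folklore]; Mathlib only
(`MeasureTheory.integral_mul_right_eq_self`).

## Provenance

Reproduced for the tree under the LEAN-IN-TREE rule (2026-08-18) from the pub-hodgecm cell's package file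
`HodgeCM/PerL34/ToricPeriodCov.lean` (DAG-node prover #06 lineage, seat pv06 generation 2, gate run 23; 78 lines,
namespace `HodgeCM.PerL34.ToricPeriodCov`), verbatim up to the namespace, the docstrings and the renaming
`PT_cov_model ↦ period_equivariant`, `PT_cov_shape ↦ period_equivariant_op`; nothing cited as a hypothesis, nothing
posited.
-/

set_option autoImplicit false

noncomputable section

open MeasureTheory

namespace Literature.MeasureTheory.Group

namespace ToricPeriod

variable {K : Type*} [Group K] [MeasurableSpace K] [MeasurableMul K] (μ : Measure K) [μ.IsMulRightInvariant]

omit [MeasurableSpace K] [MeasurableMul K] in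
/-- A unitary character inverts to its conjugate: `conj ξ(k s⁻¹) = conj ξ(k) · ξ(s)`. [folklore] -/
theorem conj_map_mul_inv (ξ : K →* ℂ) (hξ : ∀ k, ‖ξ k‖ = 1) (k s : K) :
    starRingEnd ℂ (ξ (k * s⁻¹)) = starRingEnd ℂ (ξ k) * ξ s := by
  have hinv : ξ s⁻¹ = (ξ s)⁻¹ := eq_inv_of_mul_eq_one_left (by rw [← map_mul, inv_mul_cancel, map_one])
  rw [map_mul, map_mul, hinv, Complex.inv_eq_conj (hξ s), Complex.conj_conj]

/-- **The substitution `k ↦ k s⁻¹`** (right-invariant measure): `∫ F(k s) conj ξ(k) dk = ξ(s) ∫ F(k) conj ξ(k) dk`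
for a unitary character `ξ` — the `ξ`-isotypic period of a right translate is `ξ(s)` times the period. [folklore] -/
theorem period_mul_right (ξ : K →* ℂ) (hξ : ∀ k, ‖ξ k‖ = 1) (F : K → ℂ) (s : K) :
    ∫ k, F (k * s) * starRingEnd ℂ (ξ k) ∂μ = ξ s * ∫ k, F k * starRingEnd ℂ (ξ k) ∂μ := by
  have h := integral_mul_right_eq_self (μ := μ) (fun k => F k * starRingEnd ℂ (ξ (k * s⁻¹))) s
  simp only [mul_inv_cancel_right] at h
  rw [h, ← integral_const_mul]
  refine integral_congr_ae (Filter.Eventually.of_forall fun k => ?_)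
  simp only [conj_map_mul_inv ξ hξ]
  ring

/-- **Covariance of a toric period under an equivariant action.**  `ι : K → Y` a map from the group into a space
`Y` (e.g. `[T] → [G]`, the image of a torus quotient in an automorphic quotient), `act t` an action of a group `Tc`
on `Y`, `cl : Tc →* K`, equivariance `act t (ι k) = ι (k · cl t)`; then for every `x : Y → ℂ` and unitary character
`ξ` of `K`: `∫_K x(act t (ι k)) conj ξ(k) dk = ξ(cl t) · ∫_K x(ι k) conj ξ(k) dk`. [folklore] -/
theorem period_equivariant {Y Tc : Type*} [Group Tc] (ι : K → Y) (act : Tc → Y → Y) (cl : Tc →* K)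
    (hι : ∀ (k : K) (t : Tc), act t (ι k) = ι (k * cl t)) (ξ : K →* ℂ) (hξ : ∀ k, ‖ξ k‖ = 1)
    (x : Y → ℂ) (t : Tc) :
    ∫ k, x (act t (ι k)) * starRingEnd ℂ (ξ k) ∂μ = ξ (cl t) * ∫ k, x (ι k) * starRingEnd ℂ (ξ k) ∂μ := by
  simp only [hι]
  exact period_mul_right μ ξ hξ (fun k => x (ι k)) (cl t)

/-- The same packaged over a space of "functions" `Cf` with an evaluation `ev : Cf → Y → ℂ` and translation
operators `Rc t : Cf → Cf` with `ev (Rc t x) y = ev x (act t y)`: the period functional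
`P_ξ x := ∫ ev x (ι k) conj ξ(k) dk` satisfies `P_ξ (Rc t x) = (ξ ∘ cl)(t) · P_ξ x`. [folklore] -/
theorem period_equivariant_op {Y Tc Cf : Type*} [Group Tc] (ι : K → Y) (act : Tc → Y → Y) (cl : Tc →* K)
    (hι : ∀ (k : K) (t : Tc), act t (ι k) = ι (k * cl t)) (ev : Cf → Y → ℂ) (Rc : Tc → Cf → Cf)
    (hRc : ∀ (t : Tc) (x : Cf) (y : Y), ev (Rc t x) y = ev x (act t y))
    (ξ : K →* ℂ) (hξ : ∀ k, ‖ξ k‖ = 1) (x : Cf) (t : Tc) :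
    ∫ k, ev (Rc t x) (ι k) * starRingEnd ℂ (ξ k) ∂μ = (ξ.comp cl) t * ∫ k, ev x (ι k) * starRingEnd ℂ (ξ k) ∂μ := by
  simp only [hRc, MonoidHom.comp_apply]
  exact period_equivariant μ ι act cl hι ξ hξ (ev x) t

end ToricPeriod

end Literature.MeasureTheory.Group

end
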